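import Summits.ResolutionOfSingularities.ResolutionOfSingularities.Theorems.WeightedInvariantContactCylinderGlobalMoveRegular
import Summits.ResolutionOfSingularities.ResolutionOfSingularities.Theorems.WeightedInvariantContactCylinderCompatibility
import Mathlib.RingTheory.LocalProperties.Basic
import HarnessLib

/-!
# THE GLOBAL CYLINDER MOVE: the weighted pieces `𝒥ₙ` are CONTRACTED from every local ring of the curve
# (`(𝒥ₙ · A′_𝔮) ∩ A′ = 𝒥ₙ` for all primes `𝔮 ⊇ P′` — the `hcontr` of res-type-005's TYPE (a) and of the `t⁻¹`-primitivity transfer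
# `not_tInv_dvd_map_of_forall`; door `HypersurfaceCentreConstruction`, stmt-ResolutionOfSingularities-19897, (D2) HCURVE step)

Topic: `Summits/ResolutionOfSingularities/ResolutionOfSingularities/Theorems`. Helper for the door item
`HypersurfaceCentreConstruction` (stmt-ResolutionOfSingularities-19897, route `WeightedInvariant`), line `local-engine` of
res-L1-w43-plan-1 (L W4.3).  No new objects.  `R` Noetherian, `U : Fin m → R` inside a prime `P′` with positive weights `W`, such that
`V(U) ⊆ V(P′)` and at every maximal ideal `𝔪 ⊇ P′` the local ring `R_𝔪` is regular with the `Uᵢ` linearly independent in `𝔪/𝔪²`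
(the pointwise data of `exists_basicOpen_isRegularRing_globalMove` / `globalMove_chevalleyInputs` on a basic open along the curve).
Then for every prime `𝔮 ⊇ P′` and every `n`: `((𝒥ₙ(U, W)) R_𝔮) ∩ R = 𝒥ₙ(U, W)` — LOCALLY this is res-type-005's
`comap_map_weightedMonomialIdeal_eq_of_linearIndependent` (p521270: in a regular local ring the pieces are `(U)`-primary), off `V(P′)`
the pieces are the unit ideal, and the local–global principle (`Ideal.mem_of_localization_maximal`) glues.  Consequence for the (D2)
consumer (res-D-brk-1 NOTE (N3) refined, 2026-08-27T15:30:24Z): the weighted order of `f` along the curve does not jump, and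
`t⁻¹ ∤ G ⇒ t⁻¹ ∤ ψ_𝔮 G` at EVERY point `𝔮` of the curve in the basic open (no shrink).  Door form on `A_{h h′}` at the end.

[OURS · L1 W4.3 · (o28)/(D2)]  Replaces the role of NO printed item; NOT a statement of the manuscript
[claim: Hironaka2017, status: under-review]. AI work, weaker than expert review.  Pure commutative algebra; no named facts.

## References

* H. Matsumura, *Commutative Ring Theory*, Thm. 4.3, Thm. 6.8 (primary ideals and localisation), Thm. 14.2. [Matsumura1987]
* res-type-005 `comap_map_weightedMonomialIdeal_eq_of_linearIndependent` (p521270); res-type-047 2026-08-27T14:50:40Z (consumer).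
-/

noncomputable section

open IsLocalRing Literature.AlgebraicGeometry.Resolution

set_option linter.dupNamespace false -- mandated namespace of this single-conjunct summit

namespace Summit.ResolutionOfSingularities.ResolutionOfSingularities.Theorems

namespace ContactCylinder

/-! ## Pushing a membership from `R_𝔮` to a localisation at a smaller prime -/

/-- If `a/1 ∈ I · R_𝔮` and `T` is any localisation of `R` at a prime `P ≤ 𝔮`, then `a/1 ∈ I · T` (the map `R_𝔮 → T` over `R`).
[cite: Matsumura1987, Thm. 4.3] -/
theorem algebraMap_mem_map_of_le {R : Type} [CommRing R] (P 𝔮 : Ideal R) [P.IsPrime] [𝔮.IsPrime] (hP𝔮 : P ≤ 𝔮)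
    (T : Type) [CommRing T] [Algebra R T] [IsLocalization.AtPrime T P] (I : Ideal R) {a : R}
    (ha : algebraMap R (Localization.AtPrime 𝔮) a ∈ I.map (algebraMap R (Localization.AtPrime 𝔮))) :
    algebraMap R T a ∈ I.map (algebraMap R T) := by
  have hunit : ∀ y : 𝔮.primeCompl, IsUnit (algebraMap R T y) := fun y =>
    IsLocalization.map_units (M := P.primeCompl) T ⟨y.1, show y.1 ∉ P from fun hyP => y.2 (hP𝔮 hyP)⟩
  let φ : Localization.AtPrime 𝔮 →+* T := IsLocalization.lift (M := 𝔮.primeCompl) hunit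
  have hφ : φ.comp (algebraMap R (Localization.AtPrime 𝔮)) = algebraMap R T :=
    RingHom.ext fun x => IsLocalization.lift_eq hunit x
  have h := Ideal.mem_map_of_mem φ ha
  rwa [Ideal.map_map, hφ, IsLocalization.lift_eq] at h

/-! ## The contraction theorem -/

/-- **THE WEIGHTED PIECES ARE CONTRACTED FROM EVERY LOCAL RING OF THE CURVE.**  `R` Noetherian; `U : Fin m → R` with positive weights
`W`, contained in a prime `P′` with `V(U) ⊆ V(P′)`; at every maximal `𝔪 ⊇ P′`, `R_𝔪` is regular and the `Uᵢ/1` are linearly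
independent in `𝔪/𝔪²`.  Then for every prime `𝔮 ⊇ P′` and every `n`: `((𝒥ₙ(U, W)) · R_𝔮) ∩ R = 𝒥ₙ(U, W)`.
[cite: Matsumura1987, Thm. 6.8 and Thm. 14.2] -/
theorem comap_map_weightedMonomialIdeal_eq_of_forall {R : Type} [CommRing R] {m : ℕ} (U : Fin m → R) (W : Fin m → ℕ)
    (hW : ∀ i, 0 < W i) (P' : Ideal R) [P'.IsPrime] (hUP : ∀ i, U i ∈ P')
    (hV : ∀ (𝔮 : Ideal R) [𝔮.IsPrime], (∀ i, U i ∈ 𝔮) → P' ≤ 𝔮)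
    (hreg : ∀ (𝔪 : Ideal R) [𝔪.IsMaximal], P' ≤ 𝔪 → IsRegularLocalRing (Localization.AtPrime 𝔪))
    (hli : ∀ (𝔪 : Ideal R) [𝔪.IsMaximal], P' ≤ 𝔪 →
      ∃ hU : ∀ i, algebraMap R (Localization.AtPrime 𝔪) (U i) ∈ maximalIdeal (Localization.AtPrime 𝔪),
        LinearIndependent (ResidueField (Localization.AtPrime 𝔪)) fun i =>
          (maximalIdeal (Localization.AtPrime 𝔪)).toCotangent ⟨algebraMap R _ (U i), hU i⟩)
    (𝔮 : Ideal R) [𝔮.IsPrime] (hP𝔮 : P' ≤ 𝔮) (n : ℕ) :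
    ((weightedMonomialIdeal U W n).map (algebraMap R (Localization.AtPrime 𝔮))).comap
        (algebraMap R (Localization.AtPrime 𝔮)) = weightedMonomialIdeal U W n := by
  rcases Nat.eq_zero_or_pos n with rfl | hn
  · rw [weightedMonomialIdeal_zero, Ideal.map_top, Ideal.comap_top]
  refine le_antisymm ?_ Ideal.le_comap_map
  intro a ha
  rw [Ideal.mem_comap] at ha
  refine Ideal.mem_of_localization_maximal fun 𝔪 h𝔪 => ?_
  by_cases hP𝔪 : P' ≤ 𝔪
  · -- at a point of the curve: the pieces of the regular local ring `R_𝔪` are contracted from `(R_𝔪)_{P′ R_𝔪}`, a localisation at `P′`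
    haveI := hreg 𝔪 hP𝔪
    haveI := isPrime_map_atPrime_of_le P' 𝔪 hP𝔪
    haveI := isLocalizationAtPrime_atPrime_map P' 𝔪 hP𝔪
    obtain ⟨hU, hli𝔪⟩ := hli 𝔪 hP𝔪
    have hUP' : ∀ i, algebraMap R (Localization.AtPrime 𝔪) (U i) ∈ P'.map (algebraMap R (Localization.AtPrime 𝔪)) :=
      fun i => Ideal.mem_map_of_mem _ (hUP i)
    have hloc := comap_map_weightedMonomialIdeal_eq_of_linearIndependent (P'.map (algebraMap R (Localization.AtPrime 𝔪)))
      (fun i => algebraMap R (Localization.AtPrime 𝔪) (U i)) hU hli𝔪 hUP' W hW hn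
    rw [← weightedMonomialIdeal_map] at hloc
    rw [← hloc, Ideal.mem_comap, Ideal.map_map, ← IsScalarTower.algebraMap_eq, ← IsScalarTower.algebraMap_apply]
    exact algebraMap_mem_map_of_le P' 𝔮 hP𝔮 _ _ ha
  · -- off the curve: some `Uᵢ` is a unit at `𝔪`, and `Uᵢⁿ ∈ 𝒥ₙ`, so `𝒥ₙ R_𝔪 = R_𝔪`
    have hex : ∃ i, U i ∉ 𝔪 := by
      by_contra hcon
      exact hP𝔪 (hV 𝔪 fun i => not_not.mp (not_exists.mp hcon i))
    obtain ⟨i, hi⟩ := hex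
    have hunit : IsUnit (algebraMap R (Localization.AtPrime 𝔪) (U i)) :=
      IsLocalization.map_units (M := 𝔪.primeCompl) (Localization.AtPrime 𝔪) ⟨U i, show U i ∉ 𝔪 from hi⟩
    have hpow : U i ^ n ∈ weightedMonomialIdeal U W n := by
      refine Ideal.subset_span ⟨Pi.single i n, ?_, ?_⟩
      · rw [Finset.sum_eq_single i (fun j _ hj => by rw [Pi.single_eq_of_ne hj, mul_zero])
          (fun h => absurd (Finset.mem_univ i) h), Pi.single_eq_same]
        exact Nat.le_mul_of_pos_left n (hW i)
      · rw [Finset.prod_eq_single i (fun j _ hj => by rw [Pi.single_eq_of_ne hj, pow_zero])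
          (fun h => absurd (Finset.mem_univ i) h), Pi.single_eq_same]
    have htop : (weightedMonomialIdeal U W n).map (algebraMap R (Localization.AtPrime 𝔪)) = ⊤ :=
      Ideal.eq_top_of_isUnit_mem _ (Ideal.mem_map_of_mem _ hpow) (by rw [map_pow]; exact hunit.pow n)
    rw [htop]
    exact Submodule.mem_top

/-! ## Door form: on the basic open of `exists_basicOpen_isRegularRing_globalMove`, every shrink -/

/-- Transport of the pointwise data from `A` to `A_h`: for a prime `𝔪` of `A_h` with contraction `𝔮 = 𝔪 ∩ A`, regularity of `A_𝔮` and
independence of the `Uᵢ` in its cotangent space pass to `(A_h)_𝔪 ≅ A_𝔮`. [folklore] -/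
theorem pointwise_transport_away {A : Type} [CommRing A] (h : A) {m : ℕ} (U : Fin m → A) (𝔪 : Ideal (Localization.Away h))
    [𝔪.IsPrime] (hreg : IsRegularLocalRing (Localization.AtPrime (𝔪.under A)))
    (hU : ∀ i, algebraMap A (Localization.AtPrime (𝔪.under A)) (U i) ∈ maximalIdeal (Localization.AtPrime (𝔪.under A)))
    (hli : LinearIndependent (ResidueField (Localization.AtPrime (𝔪.under A))) fun i =>
      (maximalIdeal (Localization.AtPrime (𝔪.under A))).toCotangent ⟨algebraMap A _ (U i), hU i⟩) :
    IsRegularLocalRing (Localization.AtPrime 𝔪) ∧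
      ∃ hU' : ∀ i, algebraMap (Localization.Away h) (Localization.AtPrime 𝔪) (algebraMap A (Localization.Away h) (U i)) ∈
          maximalIdeal (Localization.AtPrime 𝔪),
        LinearIndependent (ResidueField (Localization.AtPrime 𝔪)) fun i =>
          (maximalIdeal (Localization.AtPrime 𝔪)).toCotangent ⟨algebraMap (Localization.Away h) _ (algebraMap A _ (U i)), hU' i⟩ := by
  haveI : IsLocalization.AtPrime (Localization.AtPrime 𝔪) (𝔪.under A) :=
    IsLocalization.isLocalization_isLocalization_atPrime_isLocalization (Submonoid.powers h) (Localization.AtPrime 𝔪) 𝔪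
  haveI := hreg
  let e : Localization.AtPrime (𝔪.under A) ≃ₐ[A] Localization.AtPrime 𝔪 :=
    IsLocalization.algEquiv (𝔪.under A).primeCompl (Localization.AtPrime (𝔪.under A)) (Localization.AtPrime 𝔪)
  haveI : IsRegularLocalRing (Localization.AtPrime 𝔪) := IsRegularLocalRing.of_ringEquiv e.toRingEquiv
  have he : ∀ i, e.toRingEquiv (algebraMap A (Localization.AtPrime (𝔪.under A)) (U i)) =
      algebraMap (Localization.Away h) (Localization.AtPrime 𝔪) (algebraMap A (Localization.Away h) (U i)) := fun i => by
    rw [AlgEquiv.coe_ringEquiv, AlgEquiv.commutes, IsScalarTower.algebraMap_apply A (Localization.Away h)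
      (Localization.AtPrime 𝔪)]
  have hmem : ∀ i, algebraMap (Localization.Away h) (Localization.AtPrime 𝔪) (algebraMap A (Localization.Away h) (U i)) ∈
      maximalIdeal (Localization.AtPrime 𝔪) := fun i => by
    rw [← he i, AlgEquiv.coe_ringEquiv]
    exact (map_mem_nonunits_iff _ _).mpr (hU i)
  have hex : ∀ i, e.toRingEquiv (algebraMap A (Localization.AtPrime (𝔪.under A)) (U i)) ∈ maximalIdeal (Localization.AtPrime 𝔪) :=
    fun i => (he i).symm ▸ hmem i
  have hli' := linearIndependent_toCotangent_map_ringEquiv e.toRingEquiv (fun i => algebraMap A _ (U i)) hU hli hex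
  refine ⟨inferInstance, hmem, ?_⟩
  have hfun : (fun i => (maximalIdeal (Localization.AtPrime 𝔪)).toCotangent
        ⟨e.toRingEquiv (algebraMap A (Localization.AtPrime (𝔪.under A)) (U i)), hex i⟩) =
      (fun i => (maximalIdeal (Localization.AtPrime 𝔪)).toCotangent
        ⟨algebraMap (Localization.Away h) (Localization.AtPrime 𝔪) (algebraMap A (Localization.Away h) (U i)), hmem i⟩) := by
    funext i
    congr 1
    exact Subtype.ext (he i)
  rw [hfun] at hli'
  exact hli'

/-- **(D2) DOOR FORM: THE PIECES OF THE GLOBAL CYLINDER MOVE ARE CONTRACTED FROM EVERY LOCAL RING OF THE CURVE ON `D(h h′)`.**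
With the pointwise clauses of `exists_basicOpen_isRegularRing_globalMove` / `globalMove_chevalleyInputs` for `h` (regularity of `A_𝔮`
on `D(h)`; on `V(x, g) ∩ D(h)`: `𝔭 ≤ 𝔮` and independence of `x, g` in `𝔪_𝔮/𝔪_𝔮²`), for EVERY `h′`, `R := A_{h h′}`, `P′ := 𝔭 R`:
`P′` is prime (if `h h′ ∉ 𝔭`) and for every prime `𝔮′ ⊇ P′` of `R` and every `n`,
`((𝒥ₙ((x/1, g/1); (1, b))) R_{𝔮′}) ∩ R = 𝒥ₙ` — the `hcontr` of res-type-005's TYPE (a) and of `not_tInv_dvd_map_of_forall` at every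
point of the curve. [cite: Matsumura1987, Thm. 6.8 and Thm. 14.2] -/
theorem comap_map_weightedMonomialIdeal_pair_away {A : Type} [CommRing A] [IsNoetherianRing A] (h h' x g : A) (b : ℕ)
    (hb : 1 ≤ b) (𝔭 : Ideal A) [𝔭.IsPrime] (hh𝔭 : h * h' ∉ 𝔭) (hx : x ∈ 𝔭) (hg : g ∈ 𝔭)
    (Hreg : ∀ (𝔮 : Ideal A) [𝔮.IsPrime], h ∉ 𝔮 → IsRegularLocalRing (Localization.AtPrime 𝔮))
    (Hpair : ∀ (𝔮 : Ideal A) [𝔮.IsPrime], h ∉ 𝔮 → x ∈ 𝔮 → g ∈ 𝔮 →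
      𝔭 ≤ 𝔮 ∧ ∃ h𝔮 : ∀ i, algebraMap A (Localization.AtPrime 𝔮) ((![x, g] : Fin 2 → A) i) ∈ maximalIdeal (Localization.AtPrime 𝔮),
        LinearIndependent (ResidueField (Localization.AtPrime 𝔮)) fun i =>
          (maximalIdeal (Localization.AtPrime 𝔮)).toCotangent ⟨algebraMap A _ ((![x, g] : Fin 2 → A) i), h𝔮 i⟩)
    (𝔮' : Ideal (Localization.Away (h * h'))) [𝔮'.IsPrime] (h𝔮' : 𝔭.map (algebraMap A (Localization.Away (h * h'))) ≤ 𝔮') (n : ℕ) :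
    ((weightedMonomialIdeal (fun i => algebraMap A (Localization.Away (h * h')) ((![x, g] : Fin 2 → A) i)) ![1, b] n).map
        (algebraMap (Localization.Away (h * h')) (Localization.AtPrime 𝔮'))).comap
        (algebraMap (Localization.Away (h * h')) (Localization.AtPrime 𝔮')) =
      weightedMonomialIdeal (fun i => algebraMap A (Localization.Away (h * h')) ((![x, g] : Fin 2 → A) i)) ![1, b] n := by
  -- the prime `P′ = 𝔭 A_{h h′}`
  have hdisj : Disjoint ((Submonoid.powers (h * h') : Submonoid A) : Set A) (𝔭 : Set A) := by
    refine Set.disjoint_left.mpr ?_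
    rintro _ ⟨k, rfl⟩ hk
    exact hh𝔭 (‹𝔭.IsPrime›.mem_of_pow_mem _ hk)
  haveI hP' : (𝔭.map (algebraMap A (Localization.Away (h * h')))).IsPrime :=
    IsLocalization.isPrime_of_isPrime_disjoint (Submonoid.powers (h * h')) _ 𝔭 ‹_› hdisj
  haveI : IsNoetherianRing (Localization.Away (h * h')) :=
    IsLocalization.isNoetherianRing (Submonoid.powers (h * h')) (Localization.Away (h * h')) inferInstance
  -- `h ∉ 𝔪 ∩ A` for every prime `𝔪` of `A_{h h′}`
  have hnot : ∀ (𝔪 : Ideal (Localization.Away (h * h'))) [𝔪.IsPrime], h ∉ 𝔪.under A := fun 𝔪 _ hh𝔪 =>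
    ‹𝔪.IsPrime›.ne_top (𝔪.eq_top_of_isUnit_mem (Ideal.mem_comap.1 (Ideal.mul_mem_right h' _ hh𝔪))
      (IsLocalization.Away.algebraMap_isUnit (h * h')))
  have hW : ∀ i, 0 < (![1, b] : Fin 2 → ℕ) i := by
    intro i; fin_cases i
    · exact Nat.one_pos
    · exact hb
  refine comap_map_weightedMonomialIdeal_eq_of_forall _ ![1, b] hW (𝔭.map (algebraMap A (Localization.Away (h * h'))))
    ?_ ?_ ?_ ?_ 𝔮' h𝔮' n
  · intro i
    fin_cases i
    · exact Ideal.mem_map_of_mem _ hx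
    · exact Ideal.mem_map_of_mem _ hg
  · intro 𝔮 _ hU
    have hx𝔮 : x ∈ 𝔮.under A := Ideal.mem_comap.2 (hU 0)
    have hg𝔮 : g ∈ 𝔮.under A := Ideal.mem_comap.2 (hU 1)
    have h𝔭𝔮 : 𝔭 ≤ 𝔮.under A := (Hpair (𝔮.under A) (hnot 𝔮) hx𝔮 hg𝔮).1
    exact (Ideal.map_mono h𝔭𝔮).trans Ideal.map_comap_le
  · intro 𝔪 _ hP𝔪
    haveI := Hreg (𝔪.under A) (hnot 𝔪)
    have hx𝔪 : x ∈ 𝔪.under A := Ideal.mem_comap.2 (hP𝔪 (Ideal.mem_map_of_mem _ hx))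
    have hg𝔪 : g ∈ 𝔪.under A := Ideal.mem_comap.2 (hP𝔪 (Ideal.mem_map_of_mem _ hg))
    obtain ⟨-, hU, hli⟩ := Hpair (𝔪.under A) (hnot 𝔪) hx𝔪 hg𝔪
    exact (pointwise_transport_away (h * h') ![x, g] 𝔪 inferInstance hU hli).1
  · intro 𝔪 _ hP𝔪
    haveI := Hreg (𝔪.under A) (hnot 𝔪)
    have hx𝔪 : x ∈ 𝔪.under A := Ideal.mem_comap.2 (hP𝔪 (Ideal.mem_map_of_mem _ hx))
    have hg𝔪 : g ∈ 𝔪.under A := Ideal.mem_comap.2 (hP𝔪 (Ideal.mem_map_of_mem _ hg))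
    obtain ⟨-, hU, hli⟩ := Hpair (𝔪.under A) (hnot 𝔪) hx𝔪 hg𝔪
    exact (pointwise_transport_away (h * h') ![x, g] 𝔪 inferInstance hU hli).2

/-! ## rev 2 (res-type-047 ask (a), RULING #10 (V-AQS)): the door form with ARBITRARY positive weights `W : Fin 2 → ℕ` -/

/-- **(D2) DOOR FORM, ARBITRARY POSITIVE WEIGHTS**: as `comap_map_weightedMonomialIdeal_pair_away`, for the pieces
`𝒥ₙ((x/1, g/1); W)` on `A_{h h'}` (`W = (r, q)` for the (V-AQS) route). [cite: Matsumura1987, Thm. 6.8 and Thm. 14.2] -/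
theorem comap_map_weightedMonomialIdeal_pair_away' {A : Type} [CommRing A] [IsNoetherianRing A] (h h' x g : A) (W : Fin 2 → ℕ)
    (hW : ∀ i, 0 < W i) (𝔭 : Ideal A) [𝔭.IsPrime] (hh𝔭 : h * h' ∉ 𝔭) (hx : x ∈ 𝔭) (hg : g ∈ 𝔭)
    (Hreg : ∀ (𝔮 : Ideal A) [𝔮.IsPrime], h ∉ 𝔮 → IsRegularLocalRing (Localization.AtPrime 𝔮))
    (Hpair : ∀ (𝔮 : Ideal A) [𝔮.IsPrime], h ∉ 𝔮 → x ∈ 𝔮 → g ∈ 𝔮 →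
      𝔭 ≤ 𝔮 ∧ ∃ h𝔮 : ∀ i, algebraMap A (Localization.AtPrime 𝔮) ((![x, g] : Fin 2 → A) i) ∈ maximalIdeal (Localization.AtPrime 𝔮),
        LinearIndependent (ResidueField (Localization.AtPrime 𝔮)) fun i =>
          (maximalIdeal (Localization.AtPrime 𝔮)).toCotangent ⟨algebraMap A _ ((![x, g] : Fin 2 → A) i), h𝔮 i⟩)
    (𝔮' : Ideal (Localization.Away (h * h'))) [𝔮'.IsPrime] (h𝔮' : 𝔭.map (algebraMap A (Localization.Away (h * h'))) ≤ 𝔮') (n : ℕ) :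
    ((weightedMonomialIdeal (fun i => algebraMap A (Localization.Away (h * h')) ((![x, g] : Fin 2 → A) i)) W n).map
        (algebraMap (Localization.Away (h * h')) (Localization.AtPrime 𝔮'))).comap
        (algebraMap (Localization.Away (h * h')) (Localization.AtPrime 𝔮')) =
      weightedMonomialIdeal (fun i => algebraMap A (Localization.Away (h * h')) ((![x, g] : Fin 2 → A) i)) W n := by
  have hdisj : Disjoint ((Submonoid.powers (h * h') : Submonoid A) : Set A) (𝔭 : Set A) := by
    refine Set.disjoint_left.mpr ?_
    rintro _ ⟨k, rfl⟩ hk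
    exact hh𝔭 (‹𝔭.IsPrime›.mem_of_pow_mem _ hk)
  haveI hP' : (𝔭.map (algebraMap A (Localization.Away (h * h')))).IsPrime :=
    IsLocalization.isPrime_of_isPrime_disjoint (Submonoid.powers (h * h')) _ 𝔭 ‹_› hdisj
  haveI : IsNoetherianRing (Localization.Away (h * h')) :=
    IsLocalization.isNoetherianRing (Submonoid.powers (h * h')) (Localization.Away (h * h')) inferInstance
  have hnot : ∀ (𝔪 : Ideal (Localization.Away (h * h'))) [𝔪.IsPrime], h ∉ 𝔪.under A := fun 𝔪 _ hh𝔪 =>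
    ‹𝔪.IsPrime›.ne_top (𝔪.eq_top_of_isUnit_mem (Ideal.mem_comap.1 (Ideal.mul_mem_right h' _ hh𝔪))
      (IsLocalization.Away.algebraMap_isUnit (h * h')))
  refine comap_map_weightedMonomialIdeal_eq_of_forall _ W hW (𝔭.map (algebraMap A (Localization.Away (h * h'))))
    ?_ ?_ ?_ ?_ 𝔮' h𝔮' n
  · intro i
    fin_cases i
    · exact Ideal.mem_map_of_mem _ hx
    · exact Ideal.mem_map_of_mem _ hg
  · intro 𝔮 _ hU
    have hx𝔮 : x ∈ 𝔮.under A := Ideal.mem_comap.2 (hU 0)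
    have hg𝔮 : g ∈ 𝔮.under A := Ideal.mem_comap.2 (hU 1)
    have h𝔭𝔮 : 𝔭 ≤ 𝔮.under A := (Hpair (𝔮.under A) (hnot 𝔮) hx𝔮 hg𝔮).1
    exact (Ideal.map_mono h𝔭𝔮).trans Ideal.map_comap_le
  · intro 𝔪 _ hP𝔪
    haveI := Hreg (𝔪.under A) (hnot 𝔪)
    have hx𝔪 : x ∈ 𝔪.under A := Ideal.mem_comap.2 (hP𝔪 (Ideal.mem_map_of_mem _ hx))
    have hg𝔪 : g ∈ 𝔪.under A := Ideal.mem_comap.2 (hP𝔪 (Ideal.mem_map_of_mem _ hg))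
    obtain ⟨-, hU, hli⟩ := Hpair (𝔪.under A) (hnot 𝔪) hx𝔪 hg𝔪
    exact (pointwise_transport_away (h * h') ![x, g] 𝔪 inferInstance hU hli).1
  · intro 𝔪 _ hP𝔪
    haveI := Hreg (𝔪.under A) (hnot 𝔪)
    have hx𝔪 : x ∈ 𝔪.under A := Ideal.mem_comap.2 (hP𝔪 (Ideal.mem_map_of_mem _ hx))
    have hg𝔪 : g ∈ 𝔪.under A := Ideal.mem_comap.2 (hP𝔪 (Ideal.mem_map_of_mem _ hg))
    obtain ⟨-, hU, hli⟩ := Hpair (𝔪.under A) (hnot 𝔪) hx𝔪 hg𝔪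
    exact (pointwise_transport_away (h * h') ![x, g] 𝔪 inferInstance hU hli).2

end ContactCylinder

end Summit.ResolutionOfSingularities.ResolutionOfSingularities.Theorems

end
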